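import Literature.NumberTheory.Transcendental.NesterenkoEliminationCor49K
import Literature.NumberTheory.Transcendental.NesterenkoEliminationK
import Mathlib.RingTheory.Nullstellensatz
import Mathlib.RingTheory.Jacobson.Ring
import Mathlib.RingTheory.KrullDimension.Field
import HarnessLib

/-!
# LNM 1752 Ch. 3 Corollary 4.9 (non-archimedean) for primes of positive rank over an algebraically closed extension — proofs only

`Literature/NumberTheory/Transcendental/NesterenkoEliminationCor49KAlgClosed.lean` — proofs only (no
definitions, no named facts). `NesterenkoEliminationCor49K.lean` proves Cor. 4.9 of
Nesterenko–Philippon, LNM 1752 Ch. 3 §4 (`‖A‖_ω̄ ≤ ρ(ω̄)` for a form `A ∈ 𝔭`, non-archimedean `| |`)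
under the hypothesis `V_L(𝔭) ≠ ∅`. Here that hypothesis is discharged for the case of interest — `𝔭`
prime of rank `r ≥ 1` (projective dimension `≥ 0`) and `L ⊇ K` algebraically closed:

* `exists_ne_zero_forall_aeval_eq_zero` — a prime `𝔭 ⊂ k[X_σ]` with `dim k[X]/𝔭 ≠ 0` has a non-zero
  zero in `K'^σ` for every algebraically closed `K' ⊇ k` (maximal ideals above `𝔭` are ideals of
  `K'`-points by the Nullstellensatz over `k`, `MvPolynomial.eq_vanishingIdeal_singleton_of_isMaximal`;
  if all of them were the origin, `𝔭` would be maximal since `k[X]` is Jacobson);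
* `projZeros_nonempty` — `V_L(𝔭) ≠ ∅` for `𝔭` prime with `IsUnmixedOfRank 𝔭 r`, `r ≥ 1`;
* **`cor_4_9_field`** — the statement of the field `cor_4_9` of the Ch. 10 hypothesis bundle
  `NesterenkoMultiplicity.CzToolkit` (`NesterenkoMultiplicityToolkit.lean`) with `RatFunc ℂ` replaced by
  an arbitrary field `K`, for every algebraically closed ultrametric normed `L ⊇ K`.

## References

* [NesterenkoPhilippon2001] Yu. V. Nesterenko, P. Philippon (eds.), *Introduction to Algebraic
  Independence Theory*, LNM 1752, Springer 2001, Ch. 3 Cor. 4.9 (p. 40); Ch. 10 Lemma 3.4 (p. 155).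
-/

noncomputable section

open MvPolynomial

namespace Literature.NumberTheory.Transcendental

namespace NesterenkoK

attribute [local instance] MvPolynomial.gradedAlgebra

/-- **A prime of positive dimension has a non-zero zero over any algebraically closed extension.**
For a prime `𝔭 ⊂ k[X_σ]` (`σ` finite) with `dim k[X]/𝔭 ≠ 0` and an algebraically closed field `K' ⊇ k`
there is `x ∈ K'^σ`, `x ≠ 0`, with `p(x) = 0` for all `p ∈ 𝔭` (Nullstellensatz for maximal ideals over
`k`, and `k[X]` is Jacobson: if every maximal ideal above `𝔭` were the ideal of the origin, `𝔭` would be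
maximal). [folklore] -/
theorem exists_ne_zero_forall_aeval_eq_zero {k : Type*} [Field k] {K' : Type*} [Field K'] [Algebra k K']
    [IsAlgClosed K'] {σ : Type*} [Finite σ] {𝔭 : Ideal (MvPolynomial σ k)} [h𝔭 : 𝔭.IsPrime]
    (hdim : ringKrullDim (MvPolynomial σ k ⧸ 𝔭) ≠ 0) :
    ∃ x : σ → K', x ≠ 0 ∧ ∀ p ∈ 𝔭, aeval x p = 0 := by
  by_contra hcon
  push Not at hcon
  have key : ∀ P : Ideal (MvPolynomial σ k), P.IsMaximal → 𝔭 ≤ P →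
      P = vanishingIdeal k {(0 : σ → K')} := by
    intro P hP h𝔭P
    obtain ⟨x, hx⟩ := eq_vanishingIdeal_singleton_of_isMaximal K' hP
    by_cases hx0 : x = 0
    · rw [hx, hx0]
    · obtain ⟨p, hp, hne⟩ := hcon x hx0
      have : p ∈ vanishingIdeal k {x} := hx ▸ h𝔭P hp
      exact absurd ((mem_vanishingIdeal_singleton_iff x p).mp this) hne
  obtain ⟨M, hM, h𝔭M⟩ := Ideal.exists_le_maximal 𝔭 h𝔭.ne_top
  have hjac : 𝔭.jacobson = M := by
    apply le_antisymm
    · exact sInf_le ⟨h𝔭M, hM⟩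
    · refine le_sInf fun P hP => ?_
      rw [key P hP.2 hP.1, ← key M hM h𝔭M]
  have h𝔭M' : 𝔭 = M := by rw [← hjac, IsJacobsonRing.out' 𝔭 h𝔭.isRadical]
  apply hdim
  rw [h𝔭M']
  exact ringKrullDim_eq_zero_of_isField ((Ideal.Quotient.maximal_ideal_iff_isField_quotient M).mp hM)

variable {K : Type*} [Field K] {m : ℕ}

/-- A prime ideal is an associated prime of itself. [folklore] -/
theorem self_mem_associatedPrimes' {R : Type*} [CommRing R] {𝔭 : Ideal R} (h𝔭 : 𝔭.IsPrime) :
    𝔭 ∈ (𝔭 : Submodule R R).associatedPrimes := by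
  refine Submodule.AssociatePrimes.mem_iff.mpr (Submodule.isAssociatedPrime_def.mpr ⟨h𝔭, 1, ?_⟩)
  have : Submodule.colon (𝔭 : Submodule R R) {(1 : R)} = 𝔭 := by
    ext r; simp [Submodule.mem_colon_singleton]
  rw [this, h𝔭.radical]

/-- **`V_L(𝔭) ≠ ∅`** for a prime `𝔭` of rank `r ≥ 1` and an algebraically closed `L ⊇ K`. [folklore] -/
theorem projZeros_nonempty {L : Type*} [NormedField L] [Algebra K L] [IsAlgClosed L] {r : ℕ} (hr : 1 ≤ r)
    {𝔭 : Ideal (MvPolynomial (Fin (m + 1)) K)} (h𝔭 : 𝔭.IsPrime) (hunm : IsUnmixedOfRank 𝔭 r) :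
    (projZeros 𝔭 : Set (Fin (m + 1) → L)).Nonempty := by
  have hdim : ringKrullDim (MvPolynomial (Fin (m + 1)) K ⧸ 𝔭) ≠ 0 := by
    rw [hunm.2 𝔭 (self_mem_associatedPrimes' h𝔭)]
    exact_mod_cast (show r ≠ 0 by omega)
  obtain ⟨x, hx0, hx⟩ := exists_ne_zero_forall_aeval_eq_zero (K' := L) hdim
  exact ⟨x, (mem_projZeros_iff 𝔭 x).mpr ⟨hx0, hx⟩⟩

/-- **The toolkit field `CzToolkit.cor_4_9`, discharged for every algebraically closed ultrametric `L`**
(over any base field `K`): LNM 1752 Ch. 3 Cor. 4.9, non-archimedean — `‖A‖_ω̄ ≤ ρ(ω̄)` for a form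
`A ∈ 𝔭`, `𝔭` a prime of rank `r ≥ 1` (`NesterenkoK.normAt_le_rho` and `projZeros_nonempty`).
[cite: NesterenkoPhilippon2001, Ch. 3 Cor. 4.9 (p. 40)] -/
theorem cor_4_9_field {L : Type*} [NormedField L] [IsUltrametricDist L] [Algebra K L] [IsAlgClosed L]
    (m : ℕ) : ∀ (r : ℕ) (𝔭 : Ideal (MvPolynomial (Fin (m + 1)) K)), 1 ≤ r → r ≤ m → 𝔭.IsPrime →
      𝔭.IsHomogeneous (homogeneousSubmodule (Fin (m + 1)) K) → IsUnmixedOfRank 𝔭 r →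
      ∀ (A : MvPolynomial (Fin (m + 1)) K) (d : ℕ), A ∈ 𝔭 → A.IsHomogeneous d →
      ∀ ω : Fin (m + 1) → L, ω ≠ 0 → normAt ω A ≤ rho ω 𝔭 := by
  intro r 𝔭 hr _ h𝔭 _ hunm A d hA hAd ω _
  exact normAt_le_rho hA hAd ω (projZeros_nonempty hr h𝔭 hunm)

end NesterenkoK

end Literature.NumberTheory.Transcendental
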